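/- LEAD seat `ym-line-cbag-p1` (prover-ym-line-cbag-p1-g24-0), route `EguchiKawaiDirectionLadder` (ideator ym-idea-2, LINE 8),
crux K_A `TripleSmallBallMargin` (stmt-QuantumFields-27724), architecture note ARCH-27724-lead-g24 §4 (S2): ENTRYWISE RIGIDITY ON
THE CIRCLE — the statement `EntrywiseRigidity` of `…RigidityDefs` PROVED from width seat w3's sorted-line/nested engine
`HaarColumns.haar_measure_entrywise_le` (`…HaarEntrywiseRigidity`) by the consumer-side circle → line reduction: relabel the
eigenvalues in angular order starting from a cut placed after a SPARSE arc (pigeonhole), replace the chordal weights by their running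
minimum along each row (nested by construction; by unimodality of `2 − 2cos` it only caps the weights of the `≤ 2N/m` rows inside the
sparse arc, at a cost `(2/t)^{2N²/m} ≤ exp(N²(log 4 − η log t))`), and compare factor by factor with `pairFactor`.  With S3/S4/S5 landed
this makes the pair small-ball bound and the free triple bound (a′) THEOREMS.  ROUTE-INDEPENDENT (no Theses import).  Nothing here bears
on the Yang–Mills mass gap (barrier-ledger line onto `EguchiKawaiBreakdown`). -/
import Summits.QuantumFields.YangMills.Theorems.EguchiKawaiDirectionLadderHaarEntrywiseRigidity
import Summits.QuantumFields.YangMills.Theorems.EguchiKawaiDirectionLadderEntrywiseRigidityCircleLemmas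
import Mathlib.Data.Fin.Tuple.Sort
import HarnessLib

/-!
# Route `EguchiKawaiDirectionLadder`, crux `TripleSmallBallMargin`: entrywise rigidity on the circle (S2)

`entrywiseRigidity_holds : EntrywiseRigidity` — for every `η > 0` there are `κ ≥ 1`, `C ≥ 0`, `N₀` such that for all `N ≥ N₀`,
`0 < t ≤ 1` and every diagonal unitary `D = diag(d)`:
`Haar{W : S_R(D, W) ≤ t} ≤ exp(N²(C − η log t)) · ∏_{j<k} pairFactor (κt) |d_j − d_k|²`.

## Proof (consumer side of w3's engine)

* `S_R(D,W) = Σ_{j,k} x_jk |W_jk|²/(2N)`, `x_jk = |d_j − d_k|² = 2 − 2cos(φ_j − φ_k)` (`frobSq_diagonal_comm`, `norm_sub_sq_eq_angleOf`).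
* RELABEL (Haar is invariant under conjugation by permutation matrices, `haar_pair_conj`; the unordered-pair product is relabelling
  invariant, `prod_Ioi_perm`): sort the indices by the angle `φ_i ∈ [0, 2π)` measured from a CUT `c₀ = (r₀+1)·2π/m` placed at the right
  end of a grid arc containing `≤ N/m + 1` eigenvalues (pigeonhole over the `m` arcs, `exists_sparse_cell`).
* NESTED MINORANT: `a_jk := min_{l ≤ k} x_jl ≤ x_jk` is non-increasing in the column index, so w3's `haar_measure_entrywise_le` applies with
  budget `2t`: `Haar{…} ≤ e^{8N²} ∏_{k<j} (1 + a_jk/(2t))⁻¹`.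
* COMPARISON: for a row `j` with `φ_j ≤ 2π − α` (`α = 2π/m`) and `l ≤ k < j` the gaps satisfy `0 ≤ φ_j − φ_k ≤ φ_j − φ_l ≤ 2π − α`, so
  `cos(φ_j − φ_l) ≤ max(cos(φ_j − φ_k), cos α)` (`cos_le_cos_of_mem_Icc`, w2), i.e. `a_jk ≥ min(x_jk, c)`, `c = 2 − 2cos α`; hence
  `(1 + a_jk/(2t))⁻¹ ≤ pairFactor (κt) x_jk` with `κ = max 2 (8/c)`.  Rows with `φ_j > 2π − α` lie in the sparse arc (`≤ N/m + 1 ≤ 2N/m` of them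
  for `N ≥ m`) and each of their `≤ N` factors loses at most `2/t`: total `(2/t)^{2N²/m} ≤ exp(N²(log 4 − η log t))` for `m ≥ 2/η`.
-/

set_option autoImplicit false

noncomputable section

open MeasureTheory Real
open scoped ENNReal
open Literature.Barriers.QuantumFields

namespace Summit.QuantumFields.YangMills.Theorems.EguchiKawaiDirectionLadder

open Literature.MathematicalPhysics.QuantumFieldTheory (haarProbability)

variable {N : ℕ}

/-! ### D. The main theorem -/

/-- **S2: entrywise rigidity on the circle** (the statement `EntrywiseRigidity` of `…RigidityDefs`), from w3's nested engine. -/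
theorem entrywiseRigidity_holds : EntrywiseRigidity := by
  intro η hη
  -- parameters
  set m : ℕ := ⌈2 / η⌉₊ + 2 with hmdef
  have hm2 : 2 ≤ m := by omega
  have hm0 : 0 < m := by omega
  have hmη : 2 / η ≤ m := (Nat.le_ceil _).trans (by exact_mod_cast Nat.le_add_right _ _)
  set α : ℝ := 2 * π / m with hαdef
  have hα0 : 0 < α := by positivity
  have hαπ : α ≤ π := by
    rw [hαdef, div_le_iff₀ (by positivity : (0:ℝ) < m)]
    have h2 : (2 : ℝ) ≤ m := by exact_mod_cast hm2
    have := mul_le_mul_of_nonneg_left h2 Real.pi_pos.le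
    linarith
  set c : ℝ := 2 - 2 * Real.cos α with hcdef
  have hc0 : 0 < c := by
    have : Real.cos α < 1 := by
      rw [← Real.cos_zero]
      exact Real.cos_lt_cos_of_nonneg_of_le_pi le_rfl hαπ hα0
    rw [hcdef]; linarith
  set κ : ℝ := max 2 (8 / c) with hκdef
  have hκ2 : 2 ≤ κ := le_max_left _ _
  refine ⟨κ, by linarith, 8 + Real.log 4, by positivity, max m 1, fun N hN t ht ht1 D d hd => ?_⟩
  have hNm : m ≤ N := (le_max_left _ _).trans hN
  have hN1 : 1 ≤ N := (le_max_right _ _).trans hN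
  have hNpos : 0 < N := hN1
  have hNr : (0 : ℝ) < N := by exact_mod_cast hNpos
  have hd1 : ∀ i, ‖d i‖ = 1 := fun i => norm_eq_one_of_coe_eq_diagonal hd i
  -- B. the cut
  obtain ⟨r₀, hr₀, hsparse⟩ := exists_sparse_cell hm0 d
  set c₀ : ℝ := (r₀ + 1) * (2 * π / m) with hc₀def
  have hc₀0 : 0 ≤ c₀ := by positivity
  have hc₀2π : c₀ ≤ 2 * π := by
    have h1 : ((r₀ : ℝ) + 1) ≤ m := by exact_mod_cast hr₀
    calc c₀ = (r₀ + 1) * (2 * π / m) := rfl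
      _ ≤ m * (2 * π / m) := mul_le_mul_of_nonneg_right h1 (by positivity)
      _ = 2 * π := by field_simp
  set φ : Fin N → ℝ := fun i => cutAngle c₀ (d i) with hφdef
  -- A. relabel by the sorting permutation
  set σ : Equiv.Perm (Fin N) := Tuple.sort φ with hσdef
  have hmono : Monotone (φ ∘ σ) := Tuple.monotone_sort φ
  set d' : Fin N → ℂ := d ∘ σ with hd'def
  have hd'1 : ∀ i, ‖d' i‖ = 1 := fun i => hd1 _
  set D' : UN N := permUnitary σ * D * (permUnitary σ)⁻¹ with hD'def
  have hD' : (D' : Matrix (Fin N) (Fin N) ℂ) = Matrix.diagonal d' := permUnitary_conj_diagonal σ hd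
  rw [show haarProbability (UN N) {W : UN N | ekAction (![D, W] : EKConfig 2 N) ≤ t} =
      haarProbability (UN N) {W : UN N | ekAction (![D', W] : EKConfig 2 N) ≤ t} from (haar_pair_conj D (permUnitary σ) t).symm]
  rw [← prod_Ioi_perm σ (fun j k => pairFactor (κ * t) (‖d j - d k‖ ^ 2)) (fun i j => by rw [norm_sub_rev])
    (fun i j => pairFactor_nonneg (mul_nonneg (by linarith) ht.le) _)]
  change haarProbability (UN N) {W : UN N | ekAction (![D', W] : EKConfig 2 N) ≤ t} ≤
    ENNReal.ofReal (Real.exp ((N : ℝ) ^ 2 * (8 + Real.log 4 - η * Real.log t)) *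
      ∏ j : Fin N, ∏ k ∈ Finset.Ioi j, pairFactor (κ * t) (‖d' j - d' k‖ ^ 2))
  -- the weights and their running minimum
  set x : Fin N → Fin N → ℝ := fun j k => ‖d' j - d' k‖ ^ 2 with hxdef
  have hx0 : ∀ j k, 0 ≤ x j k := fun j k => by positivity
  have hx4 : ∀ j k, x j k ≤ 4 := by
    intro j k
    calc x j k = ‖d' j - d' k‖ ^ 2 := rfl
      _ ≤ (‖d' j‖ + ‖d' k‖) ^ 2 := by gcongr; exact norm_sub_le _ _
      _ = 4 := by rw [hd'1, hd'1]; norm_num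
  have hxcos : ∀ j k, x j k = 2 - 2 * Real.cos (φ (σ j) - φ (σ k)) := fun j k =>
    norm_sub_sq_eq_cutAngle c₀ (hd1 _) (hd1 _)
  set a : Fin N → Fin N → ℝ := fun j k =>
    (Finset.univ.filter fun l : Fin N => l ≤ k).inf' ⟨k, by simp⟩ (fun l => x j l) with hadef
  have ha_le : ∀ j k, a j k ≤ x j k := fun j k => Finset.inf'_le _ (by simp)
  have ha0 : ∀ j k, 0 ≤ a j k := fun j k => Finset.le_inf' _ _ fun l _ => hx0 j l
  have hamono : ∀ j k l : Fin N, l ≤ k → k < j → a j k ≤ a j l := by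
    intro j k l hlk _
    have hsub : (Finset.univ.filter fun l' : Fin N => l' ≤ l) ⊆ Finset.univ.filter fun l' : Fin N => l' ≤ k := by
      intro l' hl'
      simp only [Finset.mem_filter, Finset.mem_univ, true_and] at hl' ⊢
      exact hl'.trans hlk
    exact Finset.inf'_mono _ hsub _
  -- w3's engine with budget `2t`
  have hengine := HaarColumns.haar_measure_entrywise_le a ha0 hamono (t := 2 * t) (by linarith)
  -- event inclusion
  have hsub : {W : UN N | ekAction (![D', W] : EKConfig 2 N) ≤ t} ⊆
      {W : UN N | ∑ k, ∑ j, (if k < j then a j k * ‖(W : Matrix (Fin N) (Fin N) ℂ) j k‖ ^ 2 else 0) ≤ N * (2 * t)} := by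
    intro W hW
    simp only [Set.mem_setOf_eq] at hW ⊢
    rw [ekAction_pair_eq_frobSq hNpos, hD', frobSq_diagonal_comm, div_le_iff₀ (by positivity)] at hW
    calc ∑ k, ∑ j, (if k < j then a j k * ‖(W : Matrix (Fin N) (Fin N) ℂ) j k‖ ^ 2 else 0)
        ≤ ∑ k, ∑ j, x j k * ‖(W : Matrix (Fin N) (Fin N) ℂ) j k‖ ^ 2 := by
          refine Finset.sum_le_sum fun k _ => Finset.sum_le_sum fun j _ => ?_
          split_ifs
          · exact mul_le_mul_of_nonneg_right (ha_le j k) (by positivity)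
          · exact mul_nonneg (hx0 j k) (by positivity)
      _ = ∑ j, ∑ k, ‖d' j - d' k‖ ^ 2 * ‖(W : Matrix (Fin N) (Fin N) ℂ) j k‖ ^ 2 := Finset.sum_comm
      _ ≤ N * (2 * t) := by linarith
  refine ((measure_mono hsub).trans hengine).trans (ENNReal.ofReal_le_ofReal ?_)
  -- C. factorwise comparison
  set bad : Fin N → Prop := fun j => 2 * π - α < φ (σ j) with hbaddef
  set b : Fin N → ℝ := fun j => if bad j then 2 / t else 1 with hbdef
  have hb1 : ∀ j, 1 ≤ b j := by
    intro j; simp only [hbdef]; split_ifs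
    · rw [le_div_iff₀ ht]; linarith
    · exact le_rfl
  have hfactor : ∀ k j : Fin N, k < j →
      (1 + a j k / (2 * t))⁻¹ ≤ pairFactor (κ * t) (x j k) * b j := by
    intro k j hkj
    by_cases hj : bad j
    · simp only [hbdef, hj, if_true]
      exact inv_one_add_le_pairFactor_mul ht ht1 (hx4 j k) (ha0 j k) hκ2
    · simp only [hbdef, hj, if_false, mul_one]
      refine inv_one_add_le_pairFactor ht hc0 (hx0 j k) (hx4 j k) ?_ le_rfl
      -- good row: `a j k ≥ min (x j k) c`
      refine Finset.le_inf' _ _ fun l hl => ?_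
      have hlk : l ≤ k := (Finset.mem_filter.1 hl).2
      have hgk : 0 ≤ φ (σ j) - φ (σ k) := by
        have h := hmono hkj.le; simp only [Function.comp_apply] at h; linarith
      have hgl : φ (σ j) - φ (σ k) ≤ φ (σ j) - φ (σ l) := by
        have h := hmono hlk; simp only [Function.comp_apply] at h; linarith
      have hgl' : φ (σ j) - φ (σ l) ≤ 2 * π - α := by
        have : 0 ≤ φ (σ l) := cutAngle_nonneg hc₀2π _
        simp only [hbaddef, not_lt] at hj
        linarith
      have hcos := cos_le_max_of_gaps hα0.le hgk hgl hgl'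
      rw [hxcos j l, hxcos j k]
      rcases le_total (Real.cos (φ (σ j) - φ (σ k))) (Real.cos α) with h | h
      · rw [max_eq_right h] at hcos
        exact (min_le_right _ _).trans (by rw [hcdef]; linarith)
      · rw [max_eq_left h] at hcos
        exact (min_le_left _ _).trans (by linarith)
  -- the product of the comparison
  have hprod : ∏ k : Fin N, ∏ j : Fin N, (if k < j then (1 + a j k / (2 * t))⁻¹ else 1) ≤
      (∏ j : Fin N, ∏ k ∈ Finset.Ioi j, pairFactor (κ * t) (‖d' j - d' k‖ ^ 2)) * ∏ j : Fin N, b j ^ N := by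
    -- rewrite the target pair product with the smaller index outside, as `∏ k, ∏ j ∈ Ioi k, pf (x j k)`
    have htarget : ∏ j : Fin N, ∏ k ∈ Finset.Ioi j, pairFactor (κ * t) (‖d' j - d' k‖ ^ 2) =
        ∏ k : Fin N, ∏ j ∈ Finset.Ioi k, pairFactor (κ * t) (x j k) := by
      refine Finset.prod_congr rfl fun k _ => Finset.prod_congr rfl fun j _ => ?_
      rw [hxdef]; simp only; rw [norm_sub_rev]
    rw [htarget]
    have hIoi : ∀ k : Fin N, ∀ f : Fin N → ℝ, ∏ j, (if k < j then f j else 1) = ∏ j ∈ Finset.Ioi k, f j := by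
      intro k f
      rw [← Finset.prod_filter]
      congr 1; ext j; simp
    calc ∏ k : Fin N, ∏ j : Fin N, (if k < j then (1 + a j k / (2 * t))⁻¹ else 1)
        ≤ ∏ k : Fin N, ∏ j : Fin N, (if k < j then pairFactor (κ * t) (x j k) * b j else 1) := by
          refine Finset.prod_le_prod (fun k _ => Finset.prod_nonneg fun j _ => ?_) fun k _ => ?_
          · split_ifs
            · exact inv_nonneg.2 (by have := div_nonneg (ha0 j k) (by linarith : (0:ℝ) ≤ 2 * t); linarith)
            · exact zero_le_one
          refine Finset.prod_le_prod (fun j _ => ?_) fun j _ => ?_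
          · split_ifs
            · exact inv_nonneg.2 (by have := div_nonneg (ha0 j k) (by linarith : (0:ℝ) ≤ 2 * t); linarith)
            · exact zero_le_one
          · split_ifs with hkj
            · exact hfactor k j hkj
            · exact le_rfl
      _ = ∏ k : Fin N, ((∏ j ∈ Finset.Ioi k, pairFactor (κ * t) (x j k)) * ∏ j ∈ Finset.Ioi k, b j) := by
          refine Finset.prod_congr rfl fun k _ => ?_
          rw [hIoi k, Finset.prod_mul_distrib]
      _ = (∏ k : Fin N, ∏ j ∈ Finset.Ioi k, pairFactor (κ * t) (x j k)) * ∏ k : Fin N, ∏ j ∈ Finset.Ioi k, b j :=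
          Finset.prod_mul_distrib
      _ ≤ (∏ k : Fin N, ∏ j ∈ Finset.Ioi k, pairFactor (κ * t) (x j k)) * ∏ j : Fin N, b j ^ N := by
          refine mul_le_mul_of_nonneg_left ?_ (Finset.prod_nonneg fun k _ => Finset.prod_nonneg fun j _ =>
            pairFactor_nonneg (mul_nonneg (by linarith) ht.le) _)
          -- `∏_k ∏_{j>k} b_j ≤ ∏_j b_j^N`
          exact prod_Ioi_le_prod_pow b hb1
  -- D. bookkeeping of the bad rows
  have hbad_card : (Finset.univ.filter fun j : Fin N => bad j).card ≤ N / m + 1 := by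
    classical
    have hsub : (Finset.univ.filter fun j : Fin N => bad j) ⊆
        Finset.univ.filter fun j : Fin N => cellOf m (d (σ j)) = r₀ := by
      intro j hj
      simp only [Finset.mem_filter, Finset.mem_univ, true_and] at hj ⊢
      exact cellOf_eq_of_cutAngle_gt hm0 (d (σ j)) (by simpa [hbaddef, hφdef, hαdef, hc₀def] using hj)
    refine (Finset.card_le_card hsub).trans ?_
    rw [card_filter_comp_perm σ (fun i => cellOf m (d i) = r₀)]
    exact hsparse
  have hbprod : ∏ j : Fin N, b j ^ N ≤ Real.exp ((N : ℝ) ^ 2 * (Real.log 4 - η * Real.log t)) := by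
    classical
    have h2t : 1 ≤ 2 / t := by rw [le_div_iff₀ ht]; linarith
    rw [Finset.prod_pow]
    have hb : ∏ j : Fin N, b j = (2 / t) ^ (Finset.univ.filter fun j : Fin N => bad j).card := by
      rw [hbdef, Finset.prod_ite, Finset.prod_const, Finset.prod_const_one, mul_one]
    rw [hb, ← pow_mul, mul_comm]
    calc (2 / t) ^ (N * (Finset.univ.filter fun j : Fin N => bad j).card)
        ≤ (2 / t) ^ (N * (N / m + 1)) := pow_le_pow_right₀ h2t (Nat.mul_le_mul_left _ hbad_card)
      _ ≤ Real.exp ((N : ℝ) ^ 2 * (Real.log 4 - η * Real.log t)) := bad_rows_bookkeeping hη hmη hm0 hNm ht ht1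
  -- assemble
  have hpf0 : 0 ≤ ∏ j : Fin N, ∏ k ∈ Finset.Ioi j, pairFactor (κ * t) (‖d' j - d' k‖ ^ 2) :=
    Finset.prod_nonneg fun _ _ => Finset.prod_nonneg fun _ _ => pairFactor_nonneg (mul_nonneg (by linarith) ht.le) _
  calc Real.exp (8 * (N : ℝ) ^ 2) * ∏ k : Fin N, ∏ j : Fin N, (if k < j then (1 + a j k / (2 * t))⁻¹ else 1)
      ≤ Real.exp (8 * (N : ℝ) ^ 2) *
          ((∏ j : Fin N, ∏ k ∈ Finset.Ioi j, pairFactor (κ * t) (‖d' j - d' k‖ ^ 2)) * ∏ j : Fin N, b j ^ N) :=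
        mul_le_mul_of_nonneg_left hprod (Real.exp_pos _).le
    _ ≤ Real.exp (8 * (N : ℝ) ^ 2) *
          ((∏ j : Fin N, ∏ k ∈ Finset.Ioi j, pairFactor (κ * t) (‖d' j - d' k‖ ^ 2)) *
            Real.exp ((N : ℝ) ^ 2 * (Real.log 4 - η * Real.log t))) :=
        mul_le_mul_of_nonneg_left (mul_le_mul_of_nonneg_left hbprod hpf0) (Real.exp_pos _).le
    _ = Real.exp ((N : ℝ) ^ 2 * (8 + Real.log 4 - η * Real.log t)) *
          ∏ j : Fin N, ∏ k ∈ Finset.Ioi j, pairFactor (κ * t) (‖d' j - d' k‖ ^ 2) := by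
        rw [show (N : ℝ) ^ 2 * (8 + Real.log 4 - η * Real.log t) =
            8 * (N : ℝ) ^ 2 + (N : ℝ) ^ 2 * (Real.log 4 - η * Real.log t) by ring, Real.exp_add]
        ring

end Summit.QuantumFields.YangMills.Theorems.EguchiKawaiDirectionLadder

end
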